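import Summits.CriticalPhenomena.Ising3DConformalLimit.Theorems.LogPolarProxyProxyUniversalitySymmetries
import HarnessLib

/-!
# Crux `ProxyUniversality` (stmt-CriticalPhenomena-11288), line `registered` — the EXACT AZIMUTHAL ROTATION
# SYMMETRY of the log-polar proxy at the level of points

Route `LogPolarProxy`, sub-problem `Ising3DConformalLimit`; skeleton `Cruxes/ProxyUniversality/Lines/birth.lean`
(v4, open stub LC_pin `stub_latticeComparison`). Companion of `…Symmetries.lean` (index-level symmetries):
here the azimuthal shift `k ↦ k + 1 (mod 2N+2)` is realised in physical space. For the rotation `R_N` by the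
mesh angle `δ_N = π/(N+1)` about the `z`-axis,

* `vertex_rotate` — `v_N(R_N x) = (i, j, k + 1 mod 2N+2)` where `v_N(x) = (i, j, k)`, for EVERY `x` off the
  `z`-axis (no tie condition: the azimuthal cells `[mδ_N, (m+1)δ_N)` are permuted exactly, the branch cut of
  `Complex.arg` at `±π` included, because `2π/δ_N = 2N+2` is an integer);
* `weight_rotate` — the local renormalisation `∏ᵢ A_N(θᵢ) ρ(δ_N‖pᵢ‖)` is rotation invariant;
* `proxyAvg_rotate`, `proxyCorr_rotate` — hence `⟨∏ᵢ σ_{v_N(R_N pᵢ)}⟩_{c_N} = ⟨∏ᵢ σ_{v_N(pᵢ)}⟩_{c_N}` and the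
  renormalised proxy correlator of the crux is EXACTLY invariant under `p ↦ R_N ∘ p` on off-axis
  configurations (index-level shift symmetry `gibbsAvg_azimuthalShift`).

Consequence for the open stub (used by refuters / the transfer to isotropy): LC_pin forces
`ρ_pin(δ_N)ⁿ (⟨∏ σ_{⌊R_N^{m} pᵢ/δ_N⌋}⟩_{ℤ³} − ⟨∏ σ_{⌊pᵢ/δ_N⌋}⟩_{ℤ³}) → 0` along any `m = m_N`, i.e. asymptotic
invariance of the renormalised critical `ℤ³` correlators under rotations about a lattice axis — with the
hyperoctahedral symmetry of `ℤ³`, full `SO(3)` invariance of any continuous limit. Elementary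
(`Complex.arg` as a `Real.Angle`, floor/mod arithmetic); no definitions (the rotated point is written out
with `!₂[…]`), no named facts.

References: R. C. Brower, G. T. Fleming, H. Neuberger, Phys. Lett. B 721 (2013) 299–305 (axial rotations
of the radial lattice) [BrowerFlemingNeuberger2013]; S. Friedli, Y. Velenik, *Statistical Mechanics of
Lattice Systems* (CUP 2017), §3.7.1 [FriedliVelenik2017].
-/

noncomputable section

namespace Summit.CriticalPhenomena.Ising3DConformalLimit.Cruxes.ProxyUniversality.Birth

open scoped BigOperators
open Function
open Literature.Probability.LatticeModels

variable {N : ℕ}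

/-! ## §1 Arithmetic of the azimuthal index -/

/-- The value of the azimuthal shift as a remainder: `(k + 1) mod (2N+2)`. [folklore] -/
theorem val_finRotate_eq_mod (k : Fin (2 * N + 2)) :
    (finRotate (2 * N + 2) k).val = (k.val + 1) % (2 * N + 2) := by
  rcases val_finRotate_azimuth N k with ⟨h1, h2⟩ | ⟨h1, h2⟩
  · rw [h1, Nat.mod_eq_of_lt (by omega)]
  · rw [h1, h2, show 2 * N + 1 + 1 = 2 * N + 2 by ring, Nat.mod_self]

/-- The azimuthal floor index is at least `−(N+1)`: `arg z > −π` and `π/δ_N = N+1`. [folklore] -/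
theorem neg_le_floor_arg_div (z : ℂ) (N : ℕ) :
    -((N : ℤ) + 1) ≤ ⌊Complex.arg z / (Real.pi / ((N : ℝ) + 1))⌋ := by
  rw [Int.le_floor]
  push_cast
  have hδ : 0 < Real.pi / ((N : ℝ) + 1) := div_pos Real.pi_pos (Nat.cast_add_one_pos _)
  rw [le_div_iff₀ hδ]
  have h := Complex.neg_pi_lt_arg z
  have : -((N : ℝ) + 1) * (Real.pi / ((N : ℝ) + 1)) = -Real.pi := by
    field_simp
  rw [this]
  exact h.le

/-- Casting the azimuthal index to `ℤ`: for `0 ≤ u`, `((toNat u % m : ℕ) : ℤ) = u % m`. [folklore] -/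
theorem natCast_toNat_mod {u : ℤ} (hu : 0 ≤ u) (m : ℕ) :
    (((Int.toNat u) % m : ℕ) : ℤ) = u % (m : ℤ) := by
  rw [Int.natCast_mod, Int.toNat_of_nonneg hu]

/-! ## §2 The rotation by `δ_N` about the `z`-axis on grid vertices -/

/-- The planar part of the rotated point is the complex product with `cos δ + i sin δ`. [folklore] -/
theorem rotate_complex (δ : ℝ) (x : EuclideanSpace ℝ (Fin 3)) :
    (⟨Real.cos δ * x 0 - Real.sin δ * x 1, Real.sin δ * x 0 + Real.cos δ * x 1⟩ : ℂ) =
      ⟨x 0, x 1⟩ * (Complex.cos δ + Complex.sin δ * Complex.I) := by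
  apply Complex.ext
  · simp [Complex.mul_re, ← Complex.ofReal_cos, ← Complex.ofReal_sin]
    ring
  · simp [Complex.mul_im, ← Complex.ofReal_cos, ← Complex.ofReal_sin]
    ring

/-- The rotation about the `z`-axis preserves the norm. [folklore] -/
theorem norm_rotate (δ : ℝ) (x : EuclideanSpace ℝ (Fin 3)) :
    ‖(!₂[Real.cos δ * x 0 - Real.sin δ * x 1, Real.sin δ * x 0 + Real.cos δ * x 1, x 2] :
        EuclideanSpace ℝ (Fin 3))‖ = ‖x‖ := by
  rw [EuclideanSpace.norm_eq, EuclideanSpace.norm_eq]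
  congr 1
  simp only [Fin.sum_univ_three, Real.norm_eq_abs, sq_abs]
  simp only [Matrix.cons_val_zero, Matrix.cons_val_one, Matrix.cons_val]
  have h := Real.cos_sq_add_sin_sq δ
  nlinarith [h]

/-- The radial index of a grid vertex, as a natural number. [folklore] -/
theorem vertex_fst_val (N : ℕ) (x : EuclideanSpace ℝ (Fin 3)) :
    ((vertex N x).1).val =
      min (2 * (N + 1) ^ 2) (Int.toNat (round (Real.log ‖x‖ / (Real.pi / (N + 1))) + (N + 1) ^ 2)) :=
  rfl

/-- The polar index of a grid vertex, as a natural number. [folklore] -/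
theorem vertex_snd_fst_val (N : ℕ) (x : EuclideanSpace ℝ (Fin 3)) :
    ((vertex N x).2.1).val = min N (Int.toNat ⌊Real.arccos (x 2 / ‖x‖) / (Real.pi / (N + 1))⌋) :=
  rfl

/-- The azimuthal index of a grid vertex, as a natural number. [folklore] -/
theorem vertex_snd_snd_val (N : ℕ) (x : EuclideanSpace ℝ (Fin 3)) :
    ((vertex N x).2.2).val =
      Int.toNat (⌊Complex.arg ⟨x 0, x 1⟩ / (Real.pi / (N + 1))⌋ + (2 * N + 2)) % (2 * N + 2) :=
  rfl

/-- Components of the rotated point. [folklore] -/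
theorem rotate_apply (δ : ℝ) (x : EuclideanSpace ℝ (Fin 3)) :
    (!₂[Real.cos δ * x 0 - Real.sin δ * x 1, Real.sin δ * x 0 + Real.cos δ * x 1, x 2] :
        EuclideanSpace ℝ (Fin 3)) 0 = Real.cos δ * x 0 - Real.sin δ * x 1 ∧
      (!₂[Real.cos δ * x 0 - Real.sin δ * x 1, Real.sin δ * x 0 + Real.cos δ * x 1, x 2] :
        EuclideanSpace ℝ (Fin 3)) 1 = Real.sin δ * x 0 + Real.cos δ * x 1 ∧
      (!₂[Real.cos δ * x 0 - Real.sin δ * x 1, Real.sin δ * x 0 + Real.cos δ * x 1, x 2] :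
        EuclideanSpace ℝ (Fin 3)) 2 = x 2 :=
  ⟨rfl, rfl, rfl⟩

/-- **The grid vertex of the rotated point is the azimuthal shift of the grid vertex**, for every `x`
off the `z`-axis: `v_N(R_N x) = (i, j, k + 1 mod 2N+2)` where `v_N(x) = (i, j, k)` and `R_N` is the
rotation by `δ_N = π/(N+1)` about `e₃`. [cite: BrowerFlemingNeuberger2013, p. 4] -/
theorem vertex_rotate {x : EuclideanSpace ℝ (Fin 3)} (hx : ¬ (x 0 = 0 ∧ x 1 = 0)) :
    vertex N (!₂[Real.cos (Real.pi / ((N : ℝ) + 1)) * x 0 - Real.sin (Real.pi / ((N : ℝ) + 1)) * x 1,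
        Real.sin (Real.pi / ((N : ℝ) + 1)) * x 0 + Real.cos (Real.pi / ((N : ℝ) + 1)) * x 1, x 2] :
        EuclideanSpace ℝ (Fin 3)) =
      (((vertex N x).1, (vertex N x).2.1, finRotate (2 * N + 2) (vertex N x).2.2) : Idx N) := by
  have hδpos : 0 < Real.pi / ((N : ℝ) + 1) := div_pos Real.pi_pos (Nat.cast_add_one_pos _)
  have hδle : Real.pi / ((N : ℝ) + 1) ≤ Real.pi :=
    div_le_self Real.pi_pos.le (by linarith [(Nat.cast_nonneg N : (0:ℝ) ≤ N)])
  obtain ⟨hr0, hr1, hr2⟩ := rotate_apply (Real.pi / ((N : ℝ) + 1)) x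
  -- planar data: `z = x₀ + i x₁ ≠ 0`, `u = cos δ + i sin δ ≠ 0`, `arg u = δ`
  have hz0 : (⟨x 0, x 1⟩ : ℂ) ≠ 0 := by
    intro h
    exact hx ⟨congrArg Complex.re h, congrArg Complex.im h⟩
  have hu_arg : Complex.arg (Complex.cos (Real.pi / ((N : ℝ) + 1) : ℝ) +
      Complex.sin (Real.pi / ((N : ℝ) + 1) : ℝ) * Complex.I) = Real.pi / ((N : ℝ) + 1) :=
    Complex.arg_cos_add_sin_mul_I ⟨by linarith [Real.pi_pos], hδle⟩
  have hu0 : (Complex.cos (Real.pi / ((N : ℝ) + 1) : ℝ) +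
      Complex.sin (Real.pi / ((N : ℝ) + 1) : ℝ) * Complex.I) ≠ 0 := by
    intro h
    have h0 := Complex.arg_zero
    rw [← h, hu_arg] at h0
    exact hδpos.ne' h0
  -- the argument of the rotated point: `arg (z u) = arg z + δ + 2π k`
  obtain ⟨k, hk⟩ : ∃ k : ℤ, Complex.arg ((⟨x 0, x 1⟩ : ℂ) * (Complex.cos (Real.pi / ((N : ℝ) + 1) : ℝ) +
      Complex.sin (Real.pi / ((N : ℝ) + 1) : ℝ) * Complex.I)) -
      (Complex.arg (⟨x 0, x 1⟩ : ℂ) + Real.pi / ((N : ℝ) + 1)) = 2 * Real.pi * k := by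
    have h := Complex.arg_mul_coe_angle hz0 hu0
    rw [hu_arg, ← Real.Angle.coe_add] at h
    exact Real.Angle.angle_eq_iff_two_pi_dvd_sub.1 h
  -- hence the azimuthal floor index shifts by `1 + (2N+2) k` (`2π/δ_N = 2N+2` exactly)
  have hfloor : ⌊Complex.arg ((⟨x 0, x 1⟩ : ℂ) * (Complex.cos (Real.pi / ((N : ℝ) + 1) : ℝ) +
      Complex.sin (Real.pi / ((N : ℝ) + 1) : ℝ) * Complex.I)) / (Real.pi / ((N : ℝ) + 1))⌋ =
      ⌊Complex.arg (⟨x 0, x 1⟩ : ℂ) / (Real.pi / ((N : ℝ) + 1))⌋ + 1 + (2 * (N : ℤ) + 2) * k := by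
    have h1 : Complex.arg ((⟨x 0, x 1⟩ : ℂ) * (Complex.cos (Real.pi / ((N : ℝ) + 1) : ℝ) +
        Complex.sin (Real.pi / ((N : ℝ) + 1) : ℝ) * Complex.I)) / (Real.pi / ((N : ℝ) + 1)) =
        Complex.arg (⟨x 0, x 1⟩ : ℂ) / (Real.pi / ((N : ℝ) + 1)) +
          ((1 + (2 * (N : ℤ) + 2) * k : ℤ) : ℝ) := by
      have h2 : Complex.arg ((⟨x 0, x 1⟩ : ℂ) * (Complex.cos (Real.pi / ((N : ℝ) + 1) : ℝ) +
          Complex.sin (Real.pi / ((N : ℝ) + 1) : ℝ) * Complex.I)) =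
          Complex.arg (⟨x 0, x 1⟩ : ℂ) + Real.pi / ((N : ℝ) + 1) + 2 * Real.pi * k := by linarith
      rw [h2]
      push_cast
      field_simp
      ring
    rw [h1, Int.floor_add_intCast]
    ring
  -- the planar part of the rotated point is `z u`
  have harg : Complex.arg (⟨Real.cos (Real.pi / ((N : ℝ) + 1)) * x 0 - Real.sin (Real.pi / ((N : ℝ) + 1)) * x 1,
      Real.sin (Real.pi / ((N : ℝ) + 1)) * x 0 + Real.cos (Real.pi / ((N : ℝ) + 1)) * x 1⟩ : ℂ) =
      Complex.arg ((⟨x 0, x 1⟩ : ℂ) * (Complex.cos (Real.pi / ((N : ℝ) + 1) : ℝ) +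
        Complex.sin (Real.pi / ((N : ℝ) + 1) : ℝ) * Complex.I)) := by
    rw [rotate_complex]
  -- nonnegativity of the two azimuthal indices
  have hF := neg_le_floor_arg_div (⟨x 0, x 1⟩ : ℂ) N
  have hF' := neg_le_floor_arg_div ((⟨x 0, x 1⟩ : ℂ) * (Complex.cos (Real.pi / ((N : ℝ) + 1) : ℝ) +
      Complex.sin (Real.pi / ((N : ℝ) + 1) : ℝ) * Complex.I)) N
  rw [hfloor] at hF'
  -- compare the three components through their values
  refine Prod.ext (Fin.ext ?_) (Prod.ext (Fin.ext ?_) (Fin.ext ?_))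
  · -- radial: the norm is invariant
    rw [vertex_fst_val, vertex_fst_val, norm_rotate]
  · -- polar: `x₂` and the norm are invariant
    rw [vertex_snd_fst_val, vertex_snd_fst_val, norm_rotate, hr2]
  · -- azimuthal: shift by one, modulo `2N+2`
    show ((vertex N _).2.2).val = (finRotate (2 * N + 2) (vertex N x).2.2).val
    rw [val_finRotate_eq_mod, vertex_snd_snd_val, vertex_snd_snd_val, hr0, hr1, harg, hfloor]
    set F : ℤ := ⌊Complex.arg (⟨x 0, x 1⟩ : ℂ) / (Real.pi / ((N : ℝ) + 1))⌋ with hFdef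
    have hu0' : (0 : ℤ) ≤ F + (2 * (N : ℤ) + 2) := by omega
    have hu1' : (0 : ℤ) ≤ F + 1 + (2 * (N : ℤ) + 2) * k + (2 * (N : ℤ) + 2) := by omega
    apply Nat.cast_injective (R := ℤ)
    push_cast
    rw [Int.toNat_of_nonneg hu0', Int.toNat_of_nonneg hu1', Int.emod_add_emod,
      show F + 1 + (2 * (N : ℤ) + 2) * k + (2 * (N : ℤ) + 2) =
        (F + (2 * (N : ℤ) + 2) + 1) + (2 * (N : ℤ) + 2) * k by ring, Int.add_mul_emod_self_left]

/-! ## §3 Rotation invariance of the renormalised proxy correlator -/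

variable (Jr Jt Jp : ℕ → ℕ → ℝ) (A : ℕ → ℝ → ℝ) (ρ : ℝ → ℝ) (N)

/-- The local renormalisation `∏ᵢ A_N(θ(pᵢ)) ρ(δ_N‖pᵢ‖)` is invariant under the rotation about `e₃`
(polar angle and norm are). [folklore] -/
theorem weight_rotate {n : ℕ} (p : Fin n → EuclideanSpace ℝ (Fin 3)) :
    weight A ρ N n (fun i => (!₂[Real.cos (Real.pi / ((N : ℝ) + 1)) * p i 0 -
        Real.sin (Real.pi / ((N : ℝ) + 1)) * p i 1, Real.sin (Real.pi / ((N : ℝ) + 1)) * p i 0 +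
        Real.cos (Real.pi / ((N : ℝ) + 1)) * p i 1, p i 2] : EuclideanSpace ℝ (Fin 3))) =
      weight A ρ N n p := by
  unfold weight
  refine Finset.prod_congr rfl fun i _ => ?_
  rw [norm_rotate]
  rfl

/-- **Rotation symmetry of the proxy average at the level of points**: for off-axis configurations,
`⟨∏ᵢ σ_{v_N(R_N pᵢ)}⟩_{c_N} = ⟨∏ᵢ σ_{v_N(pᵢ)}⟩_{c_N}` (`vertex_rotate` and the index-level shift symmetry
`gibbsAvg_azimuthalShift`). [cite: BrowerFlemingNeuberger2013, p. 4] -/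
theorem proxyAvg_rotate : ∀ (Jr Jt Jp : ℕ → ℕ → ℝ) (N n : ℕ) (p : Fin n → EuclideanSpace ℝ (Fin 3)),
    (∀ i, ¬ (p i 0 = 0 ∧ p i 1 = 0)) →
    proxyAvg Jr Jt Jp N n (fun i => (!₂[Real.cos (Real.pi / ((N : ℝ) + 1)) * p i 0 -
        Real.sin (Real.pi / ((N : ℝ) + 1)) * p i 1, Real.sin (Real.pi / ((N : ℝ) + 1)) * p i 0 +
        Real.cos (Real.pi / ((N : ℝ) + 1)) * p i 1, p i 2] : EuclideanSpace ℝ (Fin 3))) =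
      proxyAvg Jr Jt Jp N n p := by
  intro Jr Jt Jp N n p hp
  rw [proxyAvg_eq, proxyAvg_eq]
  have hv : (fun i : Fin n => vertex N (!₂[Real.cos (Real.pi / ((N : ℝ) + 1)) * p i 0 -
        Real.sin (Real.pi / ((N : ℝ) + 1)) * p i 1, Real.sin (Real.pi / ((N : ℝ) + 1)) * p i 0 +
        Real.cos (Real.pi / ((N : ℝ) + 1)) * p i 1, p i 2] : EuclideanSpace ℝ (Fin 3))) =
      fun i => (((vertex N (p i)).1, (vertex N (p i)).2.1,
        finRotate (2 * N + 2) (vertex N (p i)).2.2) : Idx N) :=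
    funext fun i => vertex_rotate (hp i)
  rw [hv]
  exact gibbsAvg_azimuthalShift Jr Jt Jp N n fun i => vertex N (p i)

/-- **The renormalised proxy correlator of the crux is exactly invariant under the rotation by `δ_N` about
the `z`-axis** on off-axis configurations: `proxyCorr (R_N ∘ p) = proxyCorr p`. [cite: BrowerFlemingNeuberger2013, p. 4] -/
theorem proxyCorr_rotate : ∀ (Jr Jt Jp : ℕ → ℕ → ℝ) (A : ℕ → ℝ → ℝ) (ρ : ℝ → ℝ) (N n : ℕ)
    (p : Fin n → EuclideanSpace ℝ (Fin 3)), (∀ i, ¬ (p i 0 = 0 ∧ p i 1 = 0)) →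
    proxyCorr Jr Jt Jp A ρ N n (fun i => (!₂[Real.cos (Real.pi / ((N : ℝ) + 1)) * p i 0 -
        Real.sin (Real.pi / ((N : ℝ) + 1)) * p i 1, Real.sin (Real.pi / ((N : ℝ) + 1)) * p i 0 +
        Real.cos (Real.pi / ((N : ℝ) + 1)) * p i 1, p i 2] : EuclideanSpace ℝ (Fin 3))) =
      proxyCorr Jr Jt Jp A ρ N n p := by
  intro Jr Jt Jp A ρ N n p hp
  unfold proxyCorr
  rw [weight_rotate, proxyAvg_rotate Jr Jt Jp N n p hp]

end Summit.CriticalPhenomena.Ising3DConformalLimit.Cruxes.ProxyUniversality.Birth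

end
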